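import Mathlib
import HarnessLib

/-!
# The weights `c(n,k) = α(n) β(n,k)` of the invariant Hermitian forms on Kovačević's ray modules

Elementary real-analysis bookkeeping for `Literature.RepresentationTheory.Kovacevic2021.SU21UnitarityRays`:
[Kovacevic2021, §4 proof of Thm 4] normalises an invariant Hermitian form on a `(𝔤,K)`-module of `SU(2,1)`
`K`-type by `K`-type; in the basis `u^k_{n,m}` of `SU21ModulesFromKTypes` the weights must satisfy
`c(n,k+1) = k(n-k) c(n,k)` inside a `K`-type (unitarity of `𝔨 ≅ 𝔤𝔩₂`) and, along a north-east ray with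
`A_n = -(2n+e+1)/2`, `D = 1`, `(n+1-k)(2n+e+1)/2 · c(n+1,k) = c(n,k)`.  We solve these recursions explicitly:
`β_n(0) = 1`, `β_n(j+1) = β_n(j)(j+1)(n-1-j)` (`k = j+1`), `α(0) = 1`, `α(i+1) = 2α(i)/((n₀+i)(2(n₀+i)+e+1))`
(`n = n₀ + i`), `c(n,k) = α(n-n₀) β_n(k-1)`, and prove positivity (for `2n₀+e+1 > 0`) and the two recursions
(`rayWeight_succ_k`, `rayWeight_succ_n`; the telescoping identity `β_{n+1}(j)(n-j) = n β_n(j)`).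
Definitions with bodies; no named facts.

## References

* D. Kovačević, *Unitary `(𝔤,K)` modules of `SU(2,1)`*, Acta Math. Spalatensia 1 (2021) 105–125
  (arXiv:1810.01752): §3 Def 1, §4 Thm 4 (proof). [Kovacevic2021]
-/

noncomputable section

namespace Literature.RepresentationTheory.Kovacevic2021

namespace SU21Datum

/-! ## The weights -/

/-- `α` along the ray: `α(0) = 1`, `α(i+1) = 2α(i) / ((n₀+i)(2(n₀+i)+e+1))` [cite: Kovacevic2021, §4 proof of Thm 4] -/
def rayAlpha (e n₀ : ℤ) : ℕ → ℝ
  | 0 => 1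
  | i + 1 => rayAlpha e n₀ i * (2 / (((n₀ : ℝ) + i) * (2 * ((n₀ : ℝ) + i) + e + 1)))

/-- `β` inside the `K`-type `V_{n,m}`: `β(0) = 1`, `β(j+1) = β(j) (j+1)(n-1-j)` (`k = j + 1`)
[cite: Kovacevic2021, §3 Def 1] -/
def kBeta (n : ℤ) : ℕ → ℝ
  | 0 => 1
  | j + 1 => kBeta n j * (((j : ℝ) + 1) * ((n : ℝ) - 1 - j))

/-- the weight of `u^k_{n,3n+e}` on the ray `rayNE e n₀` [cite: Kovacevic2021, §4 proof of Thm 4] -/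
def rayWeight (e n₀ : ℤ) (n k : ℤ) : ℝ := rayAlpha e n₀ (n - n₀).toNat * kBeta n (k - 1).toNat

/-- telescoping: `β_{n+1}(j) (n - j) = n β_n(j)` [cite: Kovacevic2021, §3 Def 1] -/
theorem kBeta_succ_mul (n : ℤ) : ∀ j : ℕ, kBeta (n + 1) j * ((n : ℝ) - j) = n * kBeta n j
  | 0 => by simp [kBeta]
  | j + 1 => by
    have ih := kBeta_succ_mul n j
    simp only [kBeta]
    push_cast
    linear_combination (((j : ℝ) + 1) * ((n : ℝ) - 1 - j)) * ih

/-- `β_n(j) > 0` for `j ≤ n - 1` [cite: Kovacevic2021, §3 Def 1] -/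
theorem kBeta_pos (n : ℤ) : ∀ j : ℕ, (j : ℤ) ≤ n - 1 → 0 < kBeta n j
  | 0, _ => by simp [kBeta]
  | j + 1, hj => by
    have ih := kBeta_pos n j (by push_cast at hj; omega)
    simp only [kBeta]
    have : (0 : ℝ) < (n : ℝ) - 1 - j := by
      have : (j : ℤ) + 1 ≤ n - 1 := by exact_mod_cast hj
      have : ((j : ℤ) : ℝ) + 1 ≤ (n : ℝ) - 1 := by exact_mod_cast this
      push_cast at this
      linarith
    positivity

/-- `α(i) > 0` when `2n₀ + e + 1 > 0`, `n₀ ≥ 1` [cite: Kovacevic2021, §4 proof of Thm 4] -/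
theorem rayAlpha_pos (e n₀ : ℤ) (h₀ : 1 ≤ n₀) (he : 0 < 2 * n₀ + e + 1) : ∀ i : ℕ, 0 < rayAlpha e n₀ i
  | 0 => by simp [rayAlpha]
  | i + 1 => by
    have ih := rayAlpha_pos e n₀ h₀ he i
    simp only [rayAlpha]
    have h1 : (0 : ℝ) < (n₀ : ℝ) + i := by
      have : (1 : ℝ) ≤ n₀ := by exact_mod_cast h₀
      positivity
    have h2 : (0 : ℝ) < 2 * ((n₀ : ℝ) + i) + e + 1 := by
      have : (0 : ℝ) < 2 * (n₀ : ℝ) + e + 1 := by exact_mod_cast he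
      have : (0 : ℝ) ≤ i := by positivity
      linarith
    positivity

/-- positivity of the ray weights on admissible labels [cite: Kovacevic2021, §4 proof of Thm 4] -/
theorem rayWeight_pos (e n₀ : ℤ) (h₀ : 1 ≤ n₀) (he : 0 < 2 * n₀ + e + 1) {n k : ℤ} (hk : 1 ≤ k) (hkn : k ≤ n) :
    0 < rayWeight e n₀ n k :=
  mul_pos (rayAlpha_pos e n₀ h₀ he _) (kBeta_pos n _ (by omega))

/-- the `𝔨`-condition: `c(n,k+1) = k(n-k) c(n,k)` [cite: Kovacevic2021, §4 proof of Thm 4] -/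
theorem rayWeight_succ_k (e n₀ : ℤ) {n k : ℤ} (hk : 1 ≤ k) :
    rayWeight e n₀ n (k + 1) = rayWeight e n₀ n k * (k * (n - k)) := by
  unfold rayWeight
  have ht : (k + 1 - 1).toNat = (k - 1).toNat + 1 := by omega
  have hj : (((k - 1).toNat : ℕ) : ℝ) = (k : ℝ) - 1 := by
    have h1 : (((k - 1).toNat : ℕ) : ℤ) = k - 1 := Int.toNat_of_nonneg (by omega)
    exact_mod_cast h1
  rw [ht, kBeta, hj]
  ring

/-- the `A`–`D` edge condition: `(n+1-k) ((2n+e+1)/2) c(n+1,k) = c(n,k)` (i.e. `(n+1-k) A_n c(n+1,k) = -D c(n,k)`)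
[cite: Kovacevic2021, §4 proof of Thm 4] -/
theorem rayWeight_succ_n (e n₀ : ℤ) (h₀ : 1 ≤ n₀) (he : 0 < 2 * n₀ + e + 1) {n k : ℤ} (hn : n₀ ≤ n)
    (hk : 1 ≤ k) (hkn : k ≤ n) :
    ((n : ℝ) + 1 - k) * ((2 * n + e + 1) / 2) * rayWeight e n₀ (n + 1) k = rayWeight e n₀ n k := by
  unfold rayWeight
  have ht : (n + 1 - n₀).toNat = (n - n₀).toNat + 1 := by omega
  have hi : ((((n - n₀).toNat : ℕ)) : ℝ) = (n : ℝ) - n₀ := by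
    have h1 : (((n - n₀).toNat : ℕ) : ℤ) = n - n₀ := Int.toNat_of_nonneg (by omega)
    exact_mod_cast h1
  have hj : (((k - 1).toNat : ℕ) : ℝ) = (k : ℝ) - 1 := by
    have h1 : (((k - 1).toNat : ℕ) : ℤ) = k - 1 := Int.toNat_of_nonneg (by omega)
    exact_mod_cast h1
  have T := kBeta_succ_mul n (k - 1).toNat
  rw [hj] at T
  have hn0 : (n : ℝ) ≠ 0 := by
    have : (1 : ℝ) ≤ n := by exact_mod_cast h₀.trans hn
    linarith
  have hne : (2 * (n : ℝ) + e + 1) ≠ 0 := by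
    have : (0 : ℝ) < 2 * (n₀ : ℝ) + e + 1 := by exact_mod_cast he
    have : (n₀ : ℝ) ≤ n := by exact_mod_cast hn
    linarith
  have hnk : ((n : ℝ) + 1 - k) ≠ 0 := by
    have : (k : ℝ) ≤ n := by exact_mod_cast hkn
    linarith
  have T' : kBeta (n + 1) (k - 1).toNat = n * kBeta n (k - 1).toNat / ((n : ℝ) + 1 - k) := by
    rw [eq_div_iff hnk, show (n : ℝ) + 1 - k = n - (k - 1) by ring]
    exact T
  have hi' : (n₀ : ℝ) + (((n - n₀).toNat : ℕ) : ℝ) = n := by rw [hi]; ring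
  rw [ht, rayAlpha, hi', T']
  have hne' : ((n : ℝ) * 2 + e + 1) ≠ 0 := by convert hne using 1; ring
  have key : ((n : ℝ) + 1 - k) * ((2 * n + e + 1) / 2) * (2 / (n * (2 * n + e + 1))) * (n / (n + 1 - k)) = 1 := by
    field_simp
  calc ((n : ℝ) + 1 - k) * ((2 * n + e + 1) / 2)
        * (rayAlpha e n₀ (n - n₀).toNat * (2 / (n * (2 * n + e + 1))) * (n * kBeta n (k - 1).toNat / (n + 1 - k)))
      = rayAlpha e n₀ (n - n₀).toNat * kBeta n (k - 1).toNat
        * (((n : ℝ) + 1 - k) * ((2 * n + e + 1) / 2) * (2 / (n * (2 * n + e + 1))) * (n / (n + 1 - k))) := by ring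
    _ = rayAlpha e n₀ (n - n₀).toNat * kBeta n (k - 1).toNat := by rw [key, mul_one]

end SU21Datum

end Literature.RepresentationTheory.Kovacevic2021
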